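import Summits.HubbardSuperconductivity.HubbardSuperconductivity.Theorems.SoloBlindReciprocalCharge
import HarnessLib

/-!
# The hole-hop shell of a regular graph: mean degree and the maximal charge
# (Proposition 43, combinatorial part — generation 60)

Solo-blind programme `HubbardSuperconductivity`, generation 60: the counting half of the
ENDPOINT OF EVERY SIGN-FREE FLOOR (Proposition 43 / Corollary 43′, paper §5.20(19)).

Setting. `G` a finite simple graph on `Λ` (`n = |Λ|`), `E`-HOLE CONFIGURATIONS = subsets
`H ⊆ Λ` with `|H| = E` (the empty sites of a doublon-free Hubbard configuration; the spins of the
`n - E` electrons ride along and do not change any count below).  A HOLE HOP moves the electron at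
an occupied site `x ∉ H` into an adjacent hole `y ∈ H`, `x ∼ y`: `H ↦ insert x (H.erase y)`.
Throughout, the hop relation is written out as
`∃ x y, G.Adj x y ∧ x ∉ H ∧ y ∈ H ∧ H' = insert x (H.erase y)` (no new definitions in this file).

* `hop_symm`, `card_eq_of_hop` — hops are reversible and preserve the hole number;
* `filter_univ_hop_eq_image`, `card_filter_univ_hop`, `sum_ite_hop_eq` — the hops out of `H` are
  parametrised injectively by the MIXED ORDERED PAIRS `(x, y)`, `x ∼ y`, `x ∉ H`, `y ∈ H`; so the
  degree of `H` in the hop graph is the number of mixed ordered pairs and every hop sum is a sum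
  over them;
* `card_shell_filter_notMem_mem` — for `x ≠ y`, exactly `C(n-2, E-1)` of the `E`-subsets miss `x`
  and contain `y`;
* `sum_shell_degree` — for a `D`-regular `G`: `Σ_{|H| = E} deg H = n D · C(n-2, E-1)`, i.e. the
  MEAN DEGREE of the `E`-shell is `n D C(n-2,E-1)/C(n,E) = D E (n-E)/(n-1)`
  (`choose_identity`: `n (n-1) C(n-2,E-1) = E (n-E) C(n,E)`);
* `exists_shell_charge_mul_choose_ge`, `exists_shell_charge_ge` — MAIN: for every AM–GM admissible
  weight scheme `u` on hole hops (`u ≥ 0`, `u(H→H') u(H'→H) ≥ 1`) some `E`-hole configuration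
  collects the charge `C_u(H) = Σ_{hops H → H'} u(H→H') ≥ D E (n-E)/(n-1)`
  (`SoloBlindReciprocalCharge.exists_mem_charge_ge_sum_degree` on the shell).

For the `L × L` torus (`D = 4`, `n = L²`) this is `4 E (L² - E)/(L² - 1) > 4 ρ (1-ρ) L²`,
`ρ = E/L²` — file `SoloBlindSignFreeFloorEndpoint`.  [this work; the subset count is folklore]
-/

namespace Summit.HubbardSuperconductivity.HubbardSuperconductivity.Theorems.HoleHopShell

open Finset
open Summit.HubbardSuperconductivity.HubbardSuperconductivity.Theorems.ReciprocalCharge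

variable {Λ : Type*} [Fintype Λ] [DecidableEq Λ] (G : SimpleGraph Λ) [DecidableRel G.Adj]

/-! ### Hole hops -/

omit [Fintype Λ] [DecidableRel G.Adj] in
/-- **Hops are reversible**: if `H'` arises from `H` by the hop `(x, y)` then `H` arises from
`H'` by the hop `(y, x)`. [this work] -/
theorem hop_symm {H H' : Finset Λ}
    (h : ∃ x y, G.Adj x y ∧ x ∉ H ∧ y ∈ H ∧ H' = insert x (H.erase y)) :
    ∃ x y, G.Adj x y ∧ x ∉ H' ∧ y ∈ H' ∧ H = insert x (H'.erase y) := by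
  obtain ⟨x, y, hxy, hx, hy, rfl⟩ := h
  have hne : y ≠ x := fun h => hx (h ▸ hy)
  have hxe : x ∉ H.erase y := fun h => hx (Finset.mem_of_mem_erase h)
  refine ⟨y, x, hxy.symm, ?_, Finset.mem_insert_self x _, ?_⟩
  · intro hmem
    rcases Finset.mem_insert.1 hmem with h | h
    · exact hne h
    · exact (Finset.notMem_erase y H) h
  · rw [Finset.erase_insert hxe, Finset.insert_erase hy]

omit [Fintype Λ] [DecidableRel G.Adj] in
/-- **Hops preserve the hole number.** [this work] -/
theorem card_eq_of_hop {H H' : Finset Λ}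
    (h : ∃ x y, G.Adj x y ∧ x ∉ H ∧ y ∈ H ∧ H' = insert x (H.erase y)) :
    H'.card = H.card := by
  obtain ⟨x, y, -, hx, hy, rfl⟩ := h
  have hxe : x ∉ H.erase y := fun h => hx (Finset.mem_of_mem_erase h)
  rw [Finset.card_insert_of_notMem hxe, Finset.card_erase_of_mem hy]
  have := Finset.card_pos.2 ⟨y, hy⟩
  omega

/-! ### Hops out of `H` = mixed ordered pairs -/

/-- **The hop map is injective**: `(x, y) ↦ insert x (H.erase y)` is injective on the mixed
ordered pairs of `H` (`x` is the unique new hole, `y` the unique filled one). [this work] -/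
theorem hopMap_injOn (H : Finset Λ) :
    Set.InjOn (fun p : Λ × Λ => insert p.1 (H.erase p.2))
      ↑((univ ×ˢ univ).filter fun p : Λ × Λ => G.Adj p.1 p.2 ∧ p.1 ∉ H ∧ p.2 ∈ H) := by
  rintro ⟨x, y⟩ hp ⟨x', y'⟩ hq heq
  simp only [Finset.coe_filter, Set.mem_setOf_eq, Finset.mem_product, Finset.mem_univ,
    true_and] at hp hq
  obtain ⟨-, hx, hy⟩ := hp
  obtain ⟨-, hx', hy'⟩ := hq
  dsimp only at heq
  have hxx : x = x' := by
    have hmem : x ∈ insert x' (H.erase y') := heq ▸ Finset.mem_insert_self x _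
    rcases Finset.mem_insert.1 hmem with h | h
    · exact h
    · exact absurd (Finset.mem_of_mem_erase h) hx
  subst hxx
  have hyy : y = y' := by
    by_contra hne
    have hyx : y ≠ x := fun h => hx (h ▸ hy)
    have hmem : y ∈ insert x (H.erase y') := Finset.mem_insert_of_mem (Finset.mem_erase.2 ⟨hne, hy⟩)
    rw [← heq] at hmem
    rcases Finset.mem_insert.1 hmem with h | h
    · exact hyx h
    · exact (Finset.notMem_erase y H) h
  subst hyy
  rfl

/-- **Hops out of `H` are the images of its mixed ordered pairs.** [this work] -/
theorem filter_univ_hop_eq_image (H : Finset Λ) :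
    ((univ : Finset (Finset Λ)).filter fun H' =>
        ∃ x y, G.Adj x y ∧ x ∉ H ∧ y ∈ H ∧ H' = insert x (H.erase y)) =
      ((univ ×ˢ univ).filter fun p : Λ × Λ => G.Adj p.1 p.2 ∧ p.1 ∉ H ∧ p.2 ∈ H).image
        fun p : Λ × Λ => insert p.1 (H.erase p.2) := by
  ext H'
  simp only [Finset.mem_filter, Finset.mem_univ, true_and, Finset.mem_image, Finset.mem_product,
    Prod.exists]
  constructor
  · rintro ⟨x, y, hxy, hx, hy, rfl⟩
    exact ⟨x, y, ⟨hxy, hx, hy⟩, rfl⟩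
  · rintro ⟨x, y, ⟨hxy, hx, hy⟩, rfl⟩
    exact ⟨x, y, hxy, hx, hy, rfl⟩

/-- **Inside the shell nothing changes**: a hop out of an `E`-configuration lands in the
`E`-shell, so filtering the shell or all subsets by "is a hop of `H`" gives the same set.
[this work] -/
theorem filter_shell_hop_eq {E : ℕ} {H : Finset Λ} (hH : H.card = E) :
    ((powersetCard E (univ : Finset Λ)).filter fun H' =>
        ∃ x y, G.Adj x y ∧ x ∉ H ∧ y ∈ H ∧ H' = insert x (H.erase y)) =
      (univ : Finset (Finset Λ)).filter fun H' =>
        ∃ x y, G.Adj x y ∧ x ∉ H ∧ y ∈ H ∧ H' = insert x (H.erase y) := by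
  ext H'
  simp only [Finset.mem_filter, Finset.mem_univ, true_and, Finset.mem_powersetCard,
    Finset.subset_univ, and_iff_right_iff_imp]
  intro h
  rw [card_eq_of_hop G h, hH]

/-- **Degree = number of mixed ordered pairs.** [this work] -/
theorem card_filter_univ_hop (H : Finset Λ) :
    ((univ : Finset (Finset Λ)).filter fun H' =>
        ∃ x y, G.Adj x y ∧ x ∉ H ∧ y ∈ H ∧ H' = insert x (H.erase y)).card =
      ((univ ×ˢ univ).filter fun p : Λ × Λ => G.Adj p.1 p.2 ∧ p.1 ∉ H ∧ p.2 ∈ H).card := by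
  rw [filter_univ_hop_eq_image G H, Finset.card_image_of_injOn (hopMap_injOn G H)]

/-- **Hop sums are sums over mixed ordered pairs**: for every `g`,
`Σ_{H'} [H → H' is a hop] g H' = Σ_{(x,y) mixed} g (insert x (H.erase y))`. [this work] -/
theorem sum_ite_hop_eq (H : Finset Λ) (g : Finset Λ → ℝ) :
    (∑ H' : Finset Λ, if (∃ x y, G.Adj x y ∧ x ∉ H ∧ y ∈ H ∧ H' = insert x (H.erase y))
        then g H' else 0) =
      ∑ p ∈ (univ ×ˢ univ).filter (fun p : Λ × Λ => G.Adj p.1 p.2 ∧ p.1 ∉ H ∧ p.2 ∈ H),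
        g (insert p.1 (H.erase p.2)) := by
  rw [← Finset.sum_filter, filter_univ_hop_eq_image G H, Finset.sum_image (hopMap_injOn G H)]

/-! ### Counting -/

/-- **Subsets through a mixed pair**: for `x ≠ y` and `E ≥ 1`, exactly `C(n-2, E-1)` of the
`E`-subsets of `Λ` miss `x` and contain `y` (`H ↦ H.erase y` is a bijection onto the
`(E-1)`-subsets of `Λ ∖ {x, y}`). [folklore] -/
theorem card_shell_filter_notMem_mem {x y : Λ} (hxy : x ≠ y) {E : ℕ} (hE : 1 ≤ E) :
    ((powersetCard E (univ : Finset Λ)).filter fun H => x ∉ H ∧ y ∈ H).card =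
      (Fintype.card Λ - 2).choose (E - 1) := by
  have hcard2 : ((univ : Finset Λ) \ {x, y}).card = Fintype.card Λ - 2 := by
    rw [Finset.card_univ_sdiff, Finset.card_pair hxy]
  rw [← hcard2, ← Finset.card_powersetCard (E - 1) ((univ : Finset Λ) \ {x, y})]
  have hmemK : ∀ K ∈ powersetCard (E - 1) ((univ : Finset Λ) \ {x, y}), x ∉ K ∧ y ∉ K := by
    intro K hK
    rw [Finset.mem_powersetCard] at hK
    constructor
    · intro h
      have := hK.1 h
      rw [Finset.mem_sdiff] at this
      exact this.2 (by simp)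
    · intro h
      have := hK.1 h
      rw [Finset.mem_sdiff] at this
      exact this.2 (by simp)
  refine Finset.card_bij' (fun H _ => H.erase y) (fun K _ => insert y K) ?_ ?_ ?_ ?_
  · intro H hH
    rw [Finset.mem_filter, Finset.mem_powersetCard] at hH
    obtain ⟨⟨-, hcardH⟩, hx, hy⟩ := hH
    rw [Finset.mem_powersetCard]
    refine ⟨?_, ?_⟩
    · intro z hz
      rw [Finset.mem_erase] at hz
      rw [Finset.mem_sdiff, Finset.mem_insert, Finset.mem_singleton]
      refine ⟨Finset.mem_univ _, ?_⟩
      rintro (rfl | rfl)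
      · exact hx hz.2
      · exact hz.1 rfl
    · rw [Finset.card_erase_of_mem hy, hcardH]
  · intro K hK
    obtain ⟨hxK, hyK⟩ := hmemK K hK
    rw [Finset.mem_powersetCard] at hK
    rw [Finset.mem_filter, Finset.mem_powersetCard]
    refine ⟨⟨Finset.subset_univ _, ?_⟩, ?_, Finset.mem_insert_self _ _⟩
    · rw [Finset.card_insert_of_notMem hyK, hK.2]
      omega
    · intro h
      rcases Finset.mem_insert.1 h with h | h
      · exact hxy h
      · exact hxK h
  · intro H hH
    rw [Finset.mem_filter] at hH
    exact Finset.insert_erase hH.2.2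
  · intro K hK
    exact Finset.erase_insert (hmemK K hK).2

omit [DecidableEq Λ] in
/-- **Ordered adjacent pairs of a `D`-regular graph number `n D`.** [folklore] -/
theorem card_adjPairs_eq {D : ℕ} (hreg : ∀ x, (univ.filter fun y => G.Adj x y).card = D) :
    ((univ ×ˢ univ).filter fun p : Λ × Λ => G.Adj p.1 p.2).card = Fintype.card Λ * D := by
  rw [Finset.card_filter, Finset.sum_product]
  have h : ∀ x : Λ, (∑ y, if G.Adj x y then 1 else 0) = D := by
    intro x
    rw [← Finset.card_filter]
    exact hreg x
  simp_rw [h]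
  rw [Finset.sum_const, Finset.card_univ, smul_eq_mul]

/-- **Total degree of the `E`-shell**: for a `D`-regular `G` and `E ≥ 1`,
`Σ_{|H| = E} #{(x,y) mixed for H} = n D · C(n-2, E-1)`: every ordered adjacent pair `(x, y)` is
mixed for exactly `C(n-2, E-1)` configurations. [this work] -/
theorem sum_shell_degree {D E : ℕ} (hreg : ∀ x, (univ.filter fun y => G.Adj x y).card = D)
    (hE : 1 ≤ E) :
    (∑ H ∈ powersetCard E (univ : Finset Λ),
        ((univ ×ˢ univ).filter fun p : Λ × Λ => G.Adj p.1 p.2 ∧ p.1 ∉ H ∧ p.2 ∈ H).card) =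
      Fintype.card Λ * D * (Fintype.card Λ - 2).choose (E - 1) := by
  set S := powersetCard E (univ : Finset Λ) with hS
  set P := (univ ×ˢ univ).filter fun p : Λ × Λ => G.Adj p.1 p.2 with hP
  have h1 : ∀ H : Finset Λ,
      ((univ ×ˢ univ).filter fun p : Λ × Λ => G.Adj p.1 p.2 ∧ p.1 ∉ H ∧ p.2 ∈ H) =
        P.filter fun p => p.1 ∉ H ∧ p.2 ∈ H := by
    intro H
    rw [hP, Finset.filter_filter]
  simp_rw [h1, Finset.card_filter]
  rw [Finset.sum_comm]
  have h2 : ∀ p ∈ P, (∑ H ∈ S, if p.1 ∉ H ∧ p.2 ∈ H then 1 else 0) =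
      (Fintype.card Λ - 2).choose (E - 1) := by
    intro p hp
    rw [← Finset.card_filter]
    have hadj : G.Adj p.1 p.2 := by
      rw [hP, Finset.mem_filter] at hp
      exact hp.2
    exact card_shell_filter_notMem_mem (G.ne_of_adj hadj) hE
  rw [Finset.sum_congr rfl h2, Finset.sum_const, smul_eq_mul, card_adjPairs_eq G hreg]

/-- **The choose identity** behind the mean degree:
`(m+2)(m+1) C(m, e) = (e+1)(m+1-e) C(m+2, e+1)`, i.e. `n(n-1) C(n-2,E-1) = E(n-E) C(n,E)`
with `n = m+2`, `E = e+1`. [folklore] -/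
theorem choose_identity (m e : ℕ) :
    (m + 2) * (m + 1) * m.choose e = (e + 1) * (m + 1 - e) * (m + 2).choose (e + 1) := by
  have h1 : (m + 2) * (m + 1).choose e = (m + 2).choose (e + 1) * (e + 1) :=
    Nat.add_one_mul_choose_eq (m + 1) e
  have h2 : m.choose e * (m + 1) = (m + 1).choose e * (m + 1 - e) :=
    Nat.choose_mul_succ_eq m e
  calc (m + 2) * (m + 1) * m.choose e = (m + 2) * (m.choose e * (m + 1)) := by ring
    _ = (m + 2) * ((m + 1).choose e * (m + 1 - e)) := by rw [h2]
    _ = ((m + 2) * (m + 1).choose e) * (m + 1 - e) := by ring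
    _ = ((m + 2).choose (e + 1) * (e + 1)) * (m + 1 - e) := by rw [h1]
    _ = (e + 1) * (m + 1 - e) * (m + 2).choose (e + 1) := by ring

/-! ### The maximal charge of the shell -/

/-- **MAIN (product form).** For a `D`-regular finite simple graph, `1 ≤ E ≤ n`, and every AM–GM
admissible weight scheme `u` on hole hops (`u ≥ 0` and `u(H→H') u(H'→H) ≥ 1` on hops), some
`E`-hole configuration `H` has `C_u(H) · C(n,E) ≥ n D · C(n-2,E-1)`, where
`C_u(H) = Σ_{(x,y) mixed} u(H → insert x (H.erase y))` is the charge `H` collects — the maximal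
charge is at least the mean degree of the `E`-shell.  (`exists_mem_charge_ge_sum_degree` of
`SoloBlindReciprocalCharge` on the shell, with the hop sums rewritten over mixed pairs.)
[this work] -/
theorem exists_shell_charge_mul_choose_ge {D E : ℕ}
    (hreg : ∀ x, (univ.filter fun y => G.Adj x y).card = D) (hE : 1 ≤ E)
    (hEn : E ≤ Fintype.card Λ) (u : Finset Λ → Finset Λ → ℝ)
    (hu : ∀ H H' : Finset Λ,
      (∃ x y, G.Adj x y ∧ x ∉ H ∧ y ∈ H ∧ H' = insert x (H.erase y)) → 0 ≤ u H H')
    (huu : ∀ H H' : Finset Λ,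
      (∃ x y, G.Adj x y ∧ x ∉ H ∧ y ∈ H ∧ H' = insert x (H.erase y)) → 1 ≤ u H H' * u H' H) :
    ∃ H : Finset Λ, H.card = E ∧
      ((Fintype.card Λ * D * (Fintype.card Λ - 2).choose (E - 1) : ℕ) : ℝ) ≤
        (∑ p ∈ (univ ×ˢ univ).filter (fun p : Λ × Λ => G.Adj p.1 p.2 ∧ p.1 ∉ H ∧ p.2 ∈ H),
            u H (insert p.1 (H.erase p.2))) * ((Fintype.card Λ).choose E : ℕ) := by
  set S := powersetCard E (univ : Finset Λ) with hS
  have hSne : S.Nonempty := by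
    rw [hS, Finset.powersetCard_nonempty, Finset.card_univ]
    exact hEn
  obtain ⟨H, hHS, hle⟩ := exists_mem_charge_ge_sum_degree
    (fun H H' : Finset Λ => ∃ x y, G.Adj x y ∧ x ∉ H ∧ y ∈ H ∧ H' = insert x (H.erase y))
    (fun H H' h => hop_symm G h) u hu huu S hSne
  have hHcard : H.card = E := (Finset.mem_powersetCard.1 hHS).2
  refine ⟨H, hHcard, ?_⟩
  -- the left-hand side of `hle` is the total degree of the shell
  have hlhs : (∑ H' ∈ S, ((S.filter fun w =>
      ∃ x y, G.Adj x y ∧ x ∉ H' ∧ y ∈ H' ∧ w = insert x (H'.erase y)).card : ℝ)) =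
      ((Fintype.card Λ * D * (Fintype.card Λ - 2).choose (E - 1) : ℕ) : ℝ) := by
    rw [← sum_shell_degree G hreg hE, Nat.cast_sum]
    refine Finset.sum_congr rfl fun H' hH' => ?_
    have hH'card : H'.card = E := (Finset.mem_powersetCard.1 hH').2
    rw [filter_shell_hop_eq G hH'card, card_filter_univ_hop G H']
  -- the right-hand side: hop sum over mixed pairs, `|S| = C(n,E)`
  have hrhs : (∑ w : Finset Λ, if (∃ x y, G.Adj x y ∧ x ∉ H ∧ y ∈ H ∧ w = insert x (H.erase y))
      then u H w else 0) * (S.card : ℝ) =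
      (∑ p ∈ (univ ×ˢ univ).filter (fun p : Λ × Λ => G.Adj p.1 p.2 ∧ p.1 ∉ H ∧ p.2 ∈ H),
          u H (insert p.1 (H.erase p.2))) * ((Fintype.card Λ).choose E : ℕ) := by
    rw [sum_ite_hop_eq G H (u H), hS, Finset.card_powersetCard, Finset.card_univ]
  rw [hlhs, hrhs] at hle
  exact hle

/-- **MAIN (Proposition 43 with `φ ≡ 1`, mean-degree form).** For a `D`-regular finite simple
graph on `n ≥ 2` vertices, `1 ≤ E ≤ n`, and every AM–GM admissible weight scheme `u` on hole
hops, some `E`-hole configuration collects the charge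
`C_u(H) = Σ_{(x,y) mixed} u(H → insert x (H.erase y)) ≥ D E (n - E)/(n - 1)`
— the mean degree of the `E`-shell.  Consequently NO sign-free kinetic floor
`re ⟨ψ, T ψ⟩ ≥ -max_H C_u(H) ‖ψ‖²` built from reciprocal AM–GM weights on hole hops beats the
mean degree (paper §5.20(19), road (α)). [this work] -/
theorem exists_shell_charge_ge {D E : ℕ}
    (hreg : ∀ x, (univ.filter fun y => G.Adj x y).card = D) (hn : 2 ≤ Fintype.card Λ)
    (hE : 1 ≤ E) (hEn : E ≤ Fintype.card Λ) (u : Finset Λ → Finset Λ → ℝ)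
    (hu : ∀ H H' : Finset Λ,
      (∃ x y, G.Adj x y ∧ x ∉ H ∧ y ∈ H ∧ H' = insert x (H.erase y)) → 0 ≤ u H H')
    (huu : ∀ H H' : Finset Λ,
      (∃ x y, G.Adj x y ∧ x ∉ H ∧ y ∈ H ∧ H' = insert x (H.erase y)) → 1 ≤ u H H' * u H' H) :
    ∃ H : Finset Λ, H.card = E ∧
      (D * E * (Fintype.card Λ - E) : ℝ) / (Fintype.card Λ - 1) ≤
        ∑ p ∈ (univ ×ˢ univ).filter (fun p : Λ × Λ => G.Adj p.1 p.2 ∧ p.1 ∉ H ∧ p.2 ∈ H),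
            u H (insert p.1 (H.erase p.2)) := by
  obtain ⟨H, hHcard, hle⟩ := exists_shell_charge_mul_choose_ge G hreg hE hEn u hu huu
  refine ⟨H, hHcard, ?_⟩
  set C : ℝ := ∑ p ∈ (univ ×ˢ univ).filter (fun p : Λ × Λ => G.Adj p.1 p.2 ∧ p.1 ∉ H ∧ p.2 ∈ H),
      u H (insert p.1 (H.erase p.2)) with hC
  -- write `n = m + 2`, `E = e + 1`
  obtain ⟨m, hm⟩ : ∃ m, Fintype.card Λ = m + 2 := ⟨Fintype.card Λ - 2, by omega⟩
  obtain ⟨e, he⟩ : ∃ e, E = e + 1 := ⟨E - 1, by omega⟩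
  have hem : e ≤ m + 1 := by omega
  rw [hm, he] at hle
  simp only [Nat.add_sub_cancel] at hle
  -- `hle : ((m+2) * D * C(m, e) : ℝ) ≤ C * C(m+2, e+1)`
  have hid : ((m + 2) * (m + 1) * m.choose e : ℝ) =
      (e + 1) * (m + 1 - e) * (m + 2).choose (e + 1) := by
    have h := choose_identity m e
    have hsub : ((m + 1 - e : ℕ) : ℝ) = (m : ℝ) + 1 - e := by
      rw [Nat.cast_sub hem]; push_cast; ring
    have h' : (((m + 2) * (m + 1) * m.choose e : ℕ) : ℝ) =
        (((e + 1) * (m + 1 - e) * (m + 2).choose (e + 1) : ℕ) : ℝ) := by exact_mod_cast h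
    push_cast at h'
    rw [hsub] at h'
    linarith [h']
  have hchoose_pos : (0 : ℝ) < (m + 2).choose (e + 1) := by
    exact_mod_cast Nat.choose_pos (by omega)
  have hm1 : (0 : ℝ) < (m : ℝ) + 1 := by positivity
  -- target: D (e+1) (m+2-(e+1)) / (m+2-1) ≤ C
  have hgoal : (D * (e + 1) * ((m : ℝ) + 1 - e)) ≤ C * ((m : ℝ) + 1) := by
    -- multiply `hle` by `(m+1)` and use the identity, then cancel `C(m+2,e+1) > 0`
    have h1 : ((m + 2 : ℝ) * D * m.choose e) * (m + 1) ≤ C * (m + 2).choose (e + 1) * (m + 1) :=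
      mul_le_mul_of_nonneg_right (by exact_mod_cast hle) hm1.le
    have h2 : ((m + 2 : ℝ) * D * m.choose e) * (m + 1) =
        D * ((e + 1) * ((m : ℝ) + 1 - e)) * (m + 2).choose (e + 1) := by
      have : ((m + 2 : ℝ) * D * m.choose e) * (m + 1) = D * ((m + 2) * (m + 1) * m.choose e) := by
        ring
      rw [this, hid]; ring
    rw [h2] at h1
    have h3 : D * ((e + 1) * ((m : ℝ) + 1 - e)) ≤ C * (m + 1) :=
      le_of_mul_le_mul_right (by linarith [h1] :
        D * ((e + 1) * ((m : ℝ) + 1 - e)) * (m + 2).choose (e + 1) ≤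
          C * (m + 1) * (m + 2).choose (e + 1)) hchoose_pos
    linarith [h3]
  have hcast : ((Fintype.card Λ : ℕ) : ℝ) = (m : ℝ) + 2 := by rw [hm]; push_cast; ring
  rw [hcast, he]
  push_cast
  have hden : (m : ℝ) + 2 - 1 = m + 1 := by ring
  rw [hden, div_le_iff₀ hm1]
  have hnum : (D : ℝ) * ((e : ℝ) + 1) * ((m : ℝ) + 2 - ((e : ℝ) + 1)) = D * (e + 1) * ((m : ℝ) + 1 - e) := by
    ring
  rw [hnum]
  linarith [hgoal]

end Summit.HubbardSuperconductivity.HubbardSuperconductivity.Theorems.HoleHopShell
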